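import Summits.AnomalousDissipation.AnomalousDissipation.Theorems.SawtoothPulseCascadeK1LocalisedCascadeNToothParity

/-!
# K1loc explicit start — helper: SHARP OFF-LOBE ENERGY OF THE `N`-TOOTH CHIRP («NToothOutsideSharp»)

Helper file of the prover lane on the crux `K1LocalisedCascade` (stmt-AnomalousDissipation-19491), route `SawtoothPulseCascade`
(arbiter A24-6 (1): table campaign, sharp off-tube constants).  Refines `NToothOffLobe` by keeping the factor `|m| + |λ|` and the
parity sparsity (`NToothParity`): for the exact `N`-tooth chirp with `λ = N·L`, `E ≥ 2`,
* **`tsum_outside_sq_norm_nTooth_sharp`**: `Σ'_{|m| ≥ |λ|+NE} ‖ĝ₀(m)‖² ≤ 2L²/(π²(E+|L|)(E−1)(E+2|L|−1))`;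
(the inside counterpart is `NToothInsideSharp`).
No definitions; nothing about the crux. [cite: Grafakos2014, Prop. 3.1.2 (5), Prop. 3.2.7 (3)] [problem: turb]
-/

-- `Summit.<Summit>.<Problem>`: single-conjunct summit, the duplicate namespace segment is deliberate.
set_option linter.dupNamespace false

noncomputable section

namespace Summit.AnomalousDissipation.AnomalousDissipation.Theorems.SawtoothPulseCascade.K1Window

open MeasureTheory Filter Topology UnitAddTorus Complex AddCircle
open scoped Real
open Literature.Analysis Literature.Analysis.FunctionSpaces Literature.Analysis.FunctionSpaces.Torus Literature.Analysis.FluidPDE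
open Literature.Analysis.FluidPDE.ShearStage Literature.Analysis.FluidPDE.SawtoothCascade
open Summit.AnomalousDissipation.AnomalousDissipation.Theorems.SawtoothPulseCascade.K1Start

/-! ## §1 The sharp pointwise bound on the multiples of `N` -/

/-- On `m = Nj`, `|j| ≠ |L|`: `‖ĝ₀(Nj)‖ ≤ [L+j odd]·2|L|/(π·|L²−j²|)`. [cite: Grafakos2014, Prop. 3.1.2 (5)] -/
theorem norm_fourierCoeff_nTooth_mul_le {N : ℕ} (hN : 0 < N) {lam L : ℤ} (hL : lam = N * L) {g₀ : UnitAddCircle → ℂ}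
    (hg₀ : ∀ t : ℝ, g₀ (t : UnitAddCircle) = Complex.exp (-(2 * π * I * lam * ((tri (2 * π * N * t) / (2 * π * N) : ℝ) : ℂ))))
    {j : ℤ} (hj : |j| ≠ |L|) :
    ‖fourierCoeff g₀ ((N : ℤ) * j)‖ ≤
      if Even (L + j) then 0 else 2 * |(L : ℝ)| / (π * |((L : ℝ)) ^ 2 - (j : ℝ) ^ 2|) := by
  have hπ : 0 < π := Real.pi_pos
  have hNz : (N : ℤ) ≠ 0 := by exact_mod_cast hN.ne'
  have hNr : (0 : ℝ) < N := by exact_mod_cast hN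
  split_ifs with hev
  · rw [fourierCoeff_nTooth_eq_zero_of_even hN hL hg₀ hj hev, norm_zero]
  · have hm₁ : lam + (N : ℤ) * j ≠ 0 := by
      rw [hL, ← mul_add]; intro h
      have : L + j = 0 := (mul_eq_zero.1 h).resolve_left hNz
      exact hj (by rw [show j = -L by omega, abs_neg])
    have hm₂ : lam - (N : ℤ) * j ≠ 0 := by
      rw [hL, ← mul_sub]; intro h
      have : L - j = 0 := (mul_eq_zero.1 h).resolve_left hNz
      exact hj (by rw [show j = L by omega])
    have h := norm_fourierCoeff_nTooth_le hN lam hg₀ hm₁ hm₂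
    rw [if_pos (dvd_mul_right _ _)] at h
    refine h.trans ?_
    have hs : |Real.sin (π * ((lam : ℝ) + (((N : ℤ) * j : ℤ) : ℝ)) / (2 * N))| ≤ 1 := Real.abs_sin_le_one _
    have hne : ((L : ℝ)) ^ 2 - (j : ℝ) ^ 2 ≠ 0 := by
      intro h0
      have : |(L : ℝ)| = |(j : ℝ)| := by
        have h1 : ((L : ℝ)) ^ 2 = (j : ℝ) ^ 2 := by linarith
        exact (sq_eq_sq_iff_abs_eq_abs _ _).1 h1
      exact hj (by exact_mod_cast this.symm)
    have e : 2 * (N : ℝ) * |(lam : ℝ)| / (π * |((lam : ℝ)) ^ 2 - ((((N : ℤ) * j : ℤ)) : ℝ) ^ 2|) =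
        2 * |(L : ℝ)| / (π * |((L : ℝ)) ^ 2 - (j : ℝ) ^ 2|) := by
      rw [hL]; push_cast
      rw [abs_mul, Nat.abs_cast, show ((N : ℝ) * L) ^ 2 - ((N : ℝ) * j) ^ 2 = (N : ℝ) ^ 2 * ((L : ℝ) ^ 2 - (j : ℝ) ^ 2) by ring,
        abs_mul, abs_of_pos (by positivity : (0 : ℝ) < (N : ℝ) ^ 2)]
      field_simp
    have hpos : 0 ≤ 2 * (N : ℝ) * |(lam : ℝ)| / (π * |((lam : ℝ)) ^ 2 - ((((N : ℤ) * j : ℤ)) : ℝ) ^ 2|) := by positivity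
    calc |Real.sin (π * ((lam : ℝ) + (((N : ℤ) * j : ℤ) : ℝ)) / (2 * N))| *
          (2 * N * |(lam : ℝ)| / (π * |((lam : ℝ)) ^ 2 - ((((N : ℤ) * j : ℤ)) : ℝ) ^ 2|))
        ≤ 1 * (2 * N * |(lam : ℝ)| / (π * |((lam : ℝ)) ^ 2 - ((((N : ℤ) * j : ℤ)) : ℝ) ^ 2|)) :=
          mul_le_mul_of_nonneg_right hs hpos
      _ = 2 * |(L : ℝ)| / (π * |((L : ℝ)) ^ 2 - (j : ℝ) ^ 2|) := by rw [one_mul, e]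

/-! ## §2 Outside the lobes, sharp -/

/-- **Energy beyond the lobes, sharp**: for `λ = N·L` and `E ≥ 2`,
`Σ'_{|m| ≥ |λ| + N·E} ‖ĝ₀(m)‖² ≤ 2L²/(π²(E+|L|)(E−1)(E+2|L|−1))`. [cite: Grafakos2014, Prop. 3.1.2 (5), Prop. 3.2.7 (3)] -/
theorem tsum_outside_sq_norm_nTooth_sharp {N : ℕ} (hN : 0 < N) {lam L : ℤ} (hL : lam = N * L) {g₀ : UnitAddCircle → ℂ}
    (hg₀ : ∀ t : ℝ, g₀ (t : UnitAddCircle) = Complex.exp (-(2 * π * I * lam * ((tri (2 * π * N * t) / (2 * π * N) : ℝ) : ℂ))))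
    (hg₀c : Continuous g₀) {E : ℕ} (hE : 2 ≤ E) :
    ∑' m : ℤ, (if |lam| + (N : ℤ) * E ≤ |m| then ‖fourierCoeff g₀ m‖ ^ 2 else 0) ≤
      2 * (L : ℝ) ^ 2 / (π ^ 2 * (((E : ℝ) + |(L : ℝ)|) * (((E : ℝ) - 1) * ((E : ℝ) + 2 * |(L : ℝ)| - 1)))) := by
  classical
  have hπ : 0 < π := Real.pi_pos
  have hNr : (0 : ℝ) < N := by exact_mod_cast hN
  have hE' : (2 : ℝ) ≤ E := by exact_mod_cast hE
  have hNE1 : (1 : ℤ) ≤ (N : ℤ) * E := by nlinarith [show (1 : ℤ) ≤ N by exact_mod_cast hN, show (2 : ℤ) ≤ E by exact_mod_cast hE]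
  have hP := hasSum_sq_norm_fourierCoeff_nTooth hg₀ hg₀c
  set F : ℤ → ℝ := fun m => if |lam| + (N : ℤ) * E ≤ |m| then ‖fourierCoeff g₀ m‖ ^ 2 else 0 with hF
  have hF0 : ∀ m, 0 ≤ F m := fun m => by simp only [hF]; split_ifs <;> positivity
  have hFs : Summable F := Summable.of_nonneg_of_le hF0
    (fun m => by simp only [hF]; split_ifs; exacts [le_rfl, sq_nonneg _]) hP.summable
  have hFN : ∀ m : ℤ, ¬ (N : ℤ) ∣ m → F m = 0 := by
    intro m hd
    simp only [hF]
    split_ifs with h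
    · have hm : |m| ≠ |lam| := by omega
      rw [fourierCoeff_nTooth_eq_zero_of_not_dvd hN lam hg₀ hm hd]; simp
    · rfl
  rw [tsum_eq_tsum_multiples hN hFN]
  set G : ℤ → ℝ := fun j => F ((N : ℤ) * j) with hG
  have hGs : Summable G := hFs.comp_injective (mul_right_injective₀ (by exact_mod_cast hN.ne' : (N : ℤ) ≠ 0))
  -- majorant with parity
  set c : ℝ := (2 * |(L : ℝ)| / π) ^ 2 with hc
  set H : ℤ → ℝ := fun j => if |L| + (E : ℤ) ≤ |j| ∧ ¬ Even (L + j) then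
      c * (1 / (((|(j : ℝ)| - |(L : ℝ)|) * (|(j : ℝ)| + |(L : ℝ)|)) ^ 2)) else 0 with hH
  have hH0 : ∀ j, 0 ≤ H j := fun j => by simp only [hH]; split_ifs <;> positivity
  have habs : ∀ j : ℤ, |(N : ℤ) * j| = (N : ℤ) * |j| := fun j => by rw [abs_mul, Nat.abs_cast]
  have hlam : |lam| = (N : ℤ) * |L| := by rw [hL, abs_mul, Nat.abs_cast]
  have hGle : ∀ j, G j ≤ H j := by
    intro j
    simp only [hG, hF, hH]
    by_cases h : |L| + (E : ℤ) ≤ |j|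
    · have h' : |lam| + (N : ℤ) * E ≤ |(N : ℤ) * j| := by rw [habs, hlam]; nlinarith [show (0 : ℤ) ≤ N by positivity]
      rw [if_pos h']
      have hj : |j| ≠ |L| := by omega
      have hb := norm_fourierCoeff_nTooth_mul_le hN hL hg₀ hj
      by_cases hev : Even (L + j)
      · rw [if_pos hev] at hb
        rw [if_neg (fun h2 => h2.2 hev)]
        have : ‖fourierCoeff g₀ ((N : ℤ) * j)‖ = 0 := le_antisymm hb (norm_nonneg _)
        rw [this]; norm_num
      · rw [if_neg hev] at hb
        rw [if_pos ⟨h, hev⟩]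
        have hjr : |(L : ℝ)| + (E : ℝ) ≤ |(j : ℝ)| := by
          have : ((|L| + (E : ℤ) : ℤ) : ℝ) ≤ ((|j| : ℤ) : ℝ) := by exact_mod_cast h
          push_cast at this; exact this
        have hd0 : 0 < |(j : ℝ)| - |(L : ℝ)| := by linarith
        have hfac : |((L : ℝ)) ^ 2 - (j : ℝ) ^ 2| = (|(j : ℝ)| - |(L : ℝ)|) * (|(j : ℝ)| + |(L : ℝ)|) := by
          rw [show ((L : ℝ)) ^ 2 - (j : ℝ) ^ 2 = -((|(j : ℝ)| - |(L : ℝ)|) * (|(j : ℝ)| + |(L : ℝ)|)) by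
            rw [← sq_abs (L : ℝ), ← sq_abs (j : ℝ)]; ring, abs_neg,
            abs_of_pos (mul_pos hd0 (by linarith [abs_nonneg (L : ℝ)]))]
        rw [hfac] at hb
        calc ‖fourierCoeff g₀ ((N : ℤ) * j)‖ ^ 2 ≤ (2 * |(L : ℝ)| / (π * ((|(j : ℝ)| - |(L : ℝ)|) * (|(j : ℝ)| + |(L : ℝ)|)))) ^ 2 :=
              pow_le_pow_left₀ (norm_nonneg _) hb 2
          _ = c * (1 / (((|(j : ℝ)| - |(L : ℝ)|) * (|(j : ℝ)| + |(L : ℝ)|)) ^ 2)) := by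
              rw [hc]; field_simp
    · have h' : ¬ |lam| + (N : ℤ) * E ≤ |(N : ℤ) * j| := by
        rw [habs, hlam]; intro h''; apply h
        have hN1 : (0 : ℤ) < N := by exact_mod_cast hN
        nlinarith
      rw [if_neg h', if_neg (fun h2 => h h2.1)]
  -- rays
  set B : ℕ := L.natAbs + E with hB
  have hBz : (B : ℤ) = |L| + E := by rw [hB]; push_cast; ring
  have hBr : ((B : ℕ) : ℝ) = |(L : ℝ)| + E := by
    have h := congrArg (fun z : ℤ => (z : ℝ)) hBz
    push_cast at h; exact h
  -- parity class on the rays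
  set e₀ : ℕ := if Even (L + |L| + E) then 1 else 0 with he₀
  have hpar : ∀ e : ℕ, (¬ Even (L + ((B : ℤ) + e))) → e % 2 = e₀ := by
    intro e hne
    rw [hBz, show L + (|L| + (E : ℤ) + e) = (L + |L| + E) + e by ring, Int.even_add] at hne
    simp only [he₀]
    by_cases h1 : Even (L + |L| + (E : ℤ))
    · rw [if_pos h1]
      have : ¬ Even (e : ℤ) := fun h2 => hne ⟨fun _ => h2, fun _ => h1⟩
      rw [Int.even_coe_nat, Nat.even_iff] at this; omega
    · rw [if_neg h1]
      have : Even (e : ℤ) := by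
        by_contra h2; exact hne ⟨fun h3 => absurd h3 h1, fun h3 => absurd h3 h2⟩
      rw [Int.even_coe_nat, Nat.even_iff] at this; exact this
  have hval : ∀ e : ℕ, H ((B : ℤ) + e) ≤ c * (1 / ((((E : ℝ) + e) * ((E : ℝ) + e + 2 * |(L : ℝ)|)) ^ 2)) := by
    intro e
    simp only [hH]
    split_ifs with h
    · have e1 : |(((B : ℤ) + e : ℤ) : ℝ)| - |(L : ℝ)| = (E : ℝ) + e := by
        push_cast; rw [abs_of_nonneg (by positivity), hBr]; ring
      have e2 : |(((B : ℤ) + e : ℤ) : ℝ)| + |(L : ℝ)| = (E : ℝ) + e + 2 * |(L : ℝ)| := by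
        push_cast; rw [abs_of_nonneg (by positivity), hBr]; ring
      rw [e1, e2]
    · positivity
  have hzero : ∀ e : ℕ, e % 2 ≠ e₀ → H ((B : ℤ) + e) = 0 := by
    intro e he
    simp only [hH]
    rw [if_neg]
    rintro ⟨_, hne⟩
    exact he (hpar e hne)
  have hsym : ∀ e : ℕ, H (-((B : ℤ) + e)) = H ((B : ℤ) + e) := by
    intro e
    simp only [hH, abs_neg, Int.cast_neg]
    have : Even (L + -((B : ℤ) + e)) ↔ Even (L + ((B : ℤ) + e)) := by
      rw [show L + -((B : ℤ) + e) = (L + ((B : ℤ) + e)) - 2 * ((B : ℤ) + e) by ring, Int.even_sub]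
      exact ⟨fun h => h.2 (even_two_mul _), fun h => ⟨fun _ => even_two_mul _, fun _ => h⟩⟩
    simp only [this]
  -- summability of `H` on the rays and on `ℤ`
  have hx₀ : (2 : ℝ) ≤ (E : ℝ) + e₀ := by have : (0 : ℝ) ≤ e₀ := Nat.cast_nonneg _; linarith
  have hcL : (0 : ℝ) ≤ 2 * |(L : ℝ)| := by positivity
  have hray_s : Summable fun e : ℕ => H ((B : ℤ) + e) := by
    refine Summable.of_nonneg_of_le (fun e => hH0 _) hval ((Summable.mul_left c ?_))
    have : Summable fun e : ℕ => 1 / (((E : ℝ) + e) ^ 2) :=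
      ((summable_nat_add_iff E).2 (Real.summable_one_div_nat_pow.2 one_lt_two) |>.congr fun e => by push_cast; ring_nf)
    refine this.of_nonneg_of_le (fun e => by positivity) fun e => ?_
    have hEe : (2 : ℝ) ≤ (E : ℝ) + e := by have : (0 : ℝ) ≤ e := Nat.cast_nonneg _; linarith
    rw [mul_pow]
    exact div_le_div_of_nonneg_left zero_le_one (by positivity) (le_mul_of_one_le_right (by positivity) (by nlinarith))
  have hHs : Summable H := by
    have hinjp : Function.Injective (fun e : ℕ => (B : ℤ) + e) := fun a b h => by simpa using h
    have hinjm : Function.Injective (fun e : ℕ => -((B : ℤ) + e)) := fun a b h => by simpa using h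
    set Hp : ℤ → ℝ := fun m => if (B : ℤ) ≤ m then H m else 0 with hHp
    set Hm : ℤ → ℝ := fun m => if m ≤ -(B : ℤ) then H m else 0 with hHm
    have hsp' : ∀ m ∉ Set.range (fun e : ℕ => (B : ℤ) + e), Hp m = 0 := fun m hm => by
      simp only [hHp]; split_ifs with h
      · exact absurd ⟨(m - B).toNat, by simp only; omega⟩ hm
      · rfl
    have hsm' : ∀ m ∉ Set.range (fun e : ℕ => -((B : ℤ) + e)), Hm m = 0 := fun m hm => by
      simp only [hHm]; split_ifs with h
      · exact absurd ⟨(-m - B).toNat, by simp only; omega⟩ hm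
      · rfl
    have hHp_s : Summable Hp := by
      rw [← hinjp.summable_iff hsp']
      refine hray_s.congr fun e => ?_
      simp only [Function.comp_apply, hHp]; rw [if_pos (by omega)]
    have hHm_s : Summable Hm := by
      rw [← hinjm.summable_iff hsm']
      refine (hray_s.congr fun e => (hsym e).symm).congr fun e => ?_
      simp only [Function.comp_apply, hHm]; rw [if_pos (by omega)]
    refine (hHp_s.add hHm_s).of_nonneg_of_le hH0 fun m => ?_
    simp only [hHp, hHm]
    by_cases h1 : (B : ℤ) ≤ m
    · rw [if_pos h1]; split_ifs <;> linarith [hH0 m]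
    · rw [if_neg h1]
      by_cases h2 : m ≤ -(B : ℤ)
      · rw [if_pos h2]; linarith
      · rw [if_neg h2]
        have : H m = 0 := by
          simp only [hH]; rw [if_neg]; rintro ⟨h3, _⟩; rw [← hBz, le_abs] at h3; omega
        linarith
  have h1 : ∑' j, G j ≤ ∑' j, H j := Summable.tsum_le_tsum hGle hGs hHs
  have h2 := tsum_le_tsum_rays hH0 hHs B (fun m hm => by
    simp only [hH]; rw [if_neg]; rintro ⟨h3, _⟩; rw [← hBz] at h3; omega)
  -- the ray sums on the parity class
  have hray : ∑' e : ℕ, H ((B : ℤ) + e) ≤ c * (1 / (2 * (2 * (E : ℝ) + 2 * |(L : ℝ)|) * (((E : ℝ) - 1) * ((E : ℝ) - 1 + 2 * |(L : ℝ)|)))) := by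
    rw [tsum_eq_tsum_parity e₀ hzero]
    have hs2 : Summable fun i : ℕ => c * (1 / ((((E : ℝ) + e₀ + 2 * i) * ((E : ℝ) + e₀ + 2 * i + 2 * |(L : ℝ)|)) ^ 2)) := by
      refine Summable.mul_left c ?_
      have : Summable fun i : ℕ => 1 / (((E : ℝ) + e₀ + 2 * i) ^ 2) := by
        have h := (summable_nat_add_iff 1).2 (Real.summable_one_div_nat_pow.2 one_lt_two)
        refine (h.mul_left 1).of_nonneg_of_le (fun i => by positivity) fun i => ?_
        push_cast
        have hi : (0 : ℝ) ≤ i := Nat.cast_nonneg _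
        rw [one_mul]
        exact div_le_div_of_nonneg_left zero_le_one (by positivity) (by nlinarith)
      refine this.of_nonneg_of_le (fun i => by positivity) fun i => ?_
      have hi : (0 : ℝ) ≤ i := Nat.cast_nonneg _
      rw [mul_pow]
      exact div_le_div_of_nonneg_left zero_le_one (by positivity) (le_mul_of_one_le_right (by positivity) (by nlinarith))
    have hle : ∀ i : ℕ, H ((B : ℤ) + ((e₀ + 2 * i : ℕ) : ℤ)) ≤
        c * (1 / ((((E : ℝ) + e₀ + 2 * i) * ((E : ℝ) + e₀ + 2 * i + 2 * |(L : ℝ)|)) ^ 2)) := by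
      intro i
      refine (hval (e₀ + 2 * i)).trans (le_of_eq ?_)
      push_cast; ring_nf
    refine (Summable.tsum_le_tsum hle (hray_s.comp_injective fun a b h => by simpa using h) hs2).trans ?_
    rw [tsum_mul_left]
    refine mul_le_mul_of_nonneg_left ?_ (by positivity)
    refine (tsum_inv_sq_prod_step2_le hx₀ hcL).trans ?_
    -- monotone in `e₀ ≥ 0`
    have he0 : (0 : ℝ) ≤ e₀ := Nat.cast_nonneg _
    have hA : 0 < 2 * (2 * (E : ℝ) + 2 * |(L : ℝ)|) * (((E : ℝ) - 1) * ((E : ℝ) - 1 + 2 * |(L : ℝ)|)) := by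
      have : 0 < (E : ℝ) - 1 := by linarith
      positivity
    exact div_le_div_of_nonneg_left zero_le_one hA (by
      have h3 : (E : ℝ) - 1 ≤ (E : ℝ) + e₀ - 1 := by linarith
      have h4 : 0 < (E : ℝ) - 1 := by linarith
      apply mul_le_mul <;> nlinarith)
  have hray' : ∑' e : ℕ, H (-((B : ℤ) + e)) ≤ c * (1 / (2 * (2 * (E : ℝ) + 2 * |(L : ℝ)|) * (((E : ℝ) - 1) * ((E : ℝ) - 1 + 2 * |(L : ℝ)|)))) := by
    simp_rw [hsym]; exact hray
  have hfin : c * (1 / (2 * (2 * (E : ℝ) + 2 * |(L : ℝ)|) * (((E : ℝ) - 1) * ((E : ℝ) - 1 + 2 * |(L : ℝ)|)))) +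
      c * (1 / (2 * (2 * (E : ℝ) + 2 * |(L : ℝ)|) * (((E : ℝ) - 1) * ((E : ℝ) - 1 + 2 * |(L : ℝ)|)))) =
      2 * (L : ℝ) ^ 2 / (π ^ 2 * (((E : ℝ) + |(L : ℝ)|) * (((E : ℝ) - 1) * ((E : ℝ) + 2 * |(L : ℝ)| - 1)))) := by
    rw [hc, ← sq_abs (L : ℝ)]
    have h4 : 0 < (E : ℝ) - 1 := by linarith
    have h5 : 0 < (E : ℝ) + |(L : ℝ)| := by positivity
    have h6 : 0 < (E : ℝ) + 2 * |(L : ℝ)| - 1 := by linarith [abs_nonneg (L : ℝ)]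
    field_simp
    ring
  linarith

end Summit.AnomalousDissipation.AnomalousDissipation.Theorems.SawtoothPulseCascade.K1Window
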